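import Mathlib.LinearAlgebra.Matrix.Determinant.Basic
import Mathlib.LinearAlgebra.Matrix.Notation
import Mathlib.Data.Matrix.Mul
import Mathlib.RingTheory.Coprime.Lemmas
import Mathlib.Data.Int.GCD
import Mathlib.Tactic
import HarnessLib

/-!
# Normal forms of trace-zero elements of `GL₂(ℤ)` under `SL₂(ℤ)`-conjugation

Topic `Literature/LinearAlgebra/Matrix`. Everything here is PROVED (no named facts).

An integral `2 × 2` matrix `γ` with trace `0` and determinant `±1` satisfies `γ² = −det γ`
(Cayley–Hamilton); these are exactly the non-central elements of finite order `2` or `4` of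
`GL₂(ℤ)`. We prove the classical normal forms:

* `involution_normal_form`: if `det γ = −1` (`γ² = 1`) there is `δ ∈ SL₂(ℤ)` with
  `γ δ = δ · diag(1, −1)` or `γ δ = δ · (1 1; 0 −1)` — by completing a primitive eigenvector to a
  basis (Bezout) and a shear;
* `order_four_normal_form`: if `det γ = 1` (`γ² = −1`) there is `δ ∈ SL₂(ℤ)` with
  `γ δ = ± δ S`, `S = (0 −1; 1 0)` — by **reduction of the positive definite binary quadratic
  form `Jγ` of discriminant `−4`** (`Q`): a minimal vector is primitive, completing it to a basis
  and shearing gives a reduced form `(m, ρ, c)` with `0 ≤ ρ < m ≤ c`, `mc − ρ² = 1`, whence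
  `m = c = 1`, `ρ = 0`;
* `trace_zero_normal_form`: the four normal forms together.

These are used to bound the number of `GL₂(ℤ)`-classes of integral binary quartic forms with a
stabilizer of size `> 2` (Bhargava–Shankar, Lemma 2.4) through the fixed subspaces of the normal
forms.

## References

* Folklore (conjugacy classes of finite-order elements of `GL₂(ℤ)`; Gauss reduction of definite
  binary quadratic forms). [folklore]
-/

namespace Literature.LinearAlgebra.Matrix

namespace GL2ZNormalForm

open Matrix

/-- `diag(1, −1)`. [folklore] -/
def γ₁ : Matrix (Fin 2) (Fin 2) ℤ := !![1, 0; 0, -1]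

/-- `(1 1; 0 −1)`. [folklore] -/
def γ₂ : Matrix (Fin 2) (Fin 2) ℤ := !![1, 1; 0, -1]

/-- `S = (0 −1; 1 0)`. [folklore] -/
def S : Matrix (Fin 2) (Fin 2) ℤ := !![0, -1; 1, 0]

/-! ## Primitive vectors and Bezout -/

/-- A nonzero integral vector is a positive multiple of a primitive one. [folklore] -/
theorem exists_primitive (u₁ u₂ : ℤ) (h : u₁ ≠ 0 ∨ u₂ ≠ 0) :
    ∃ g w₁ w₂ : ℤ, 0 < g ∧ u₁ = g * w₁ ∧ u₂ = g * w₂ ∧ IsCoprime w₁ w₂ := by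
  have hg : 0 < Int.gcd u₁ u₂ := Int.gcd_pos_iff.2 h
  obtain ⟨w₁, hw₁⟩ := Int.gcd_dvd_left u₁ u₂
  obtain ⟨w₂, hw₂⟩ := Int.gcd_dvd_right u₁ u₂
  refine ⟨Int.gcd u₁ u₂, w₁, w₂, by exact_mod_cast hg, hw₁, hw₂, ?_⟩
  rw [Int.isCoprime_iff_gcd_eq_one]
  have h1 := Int.gcd_mul_left (Int.gcd u₁ u₂ : ℤ) w₁ w₂
  rw [← hw₁, ← hw₂, Int.natAbs_natCast] at h1
  have hg' : Int.gcd u₁ u₂ ≠ 0 := hg.ne'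
  have : Int.gcd u₁ u₂ * Int.gcd w₁ w₂ = Int.gcd u₁ u₂ * 1 := by rw [mul_one]; exact h1.symm
  exact Nat.eq_of_mul_eq_mul_left hg this

/-! ## Involutions of determinant `−1` -/

/-- **Normal form of integral involutions**: an integral `2 × 2` matrix with trace `0` and
determinant `−1` is `SL₂(ℤ)`-conjugate to `diag(1, −1)` or to `(1 1; 0 −1)`: there is
`δ ∈ SL₂(ℤ)` with `γ δ = δ γ₁` or `γ δ = δ γ₂`. [folklore] -/
theorem involution_normal_form (γ : Matrix (Fin 2) (Fin 2) ℤ) (htr : γ 0 0 + γ 1 1 = 0) (hdet : γ.det = -1) :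
    ∃ δ : Matrix (Fin 2) (Fin 2) ℤ, δ.det = 1 ∧ (γ * δ = δ * γ₁ ∨ γ * δ = δ * γ₂) := by
  set p := γ 0 0
  set q := γ 0 1
  set r := γ 1 0
  have h11 : γ 1 1 = -p := by linarith
  rw [Matrix.det_fin_two, h11] at hdet
  have hrel : p ^ 2 + q * r = 1 := by linarith
  -- an eigenvector `u` with `γ u = u`, `u ≠ 0`
  obtain ⟨u₁, u₂, hu0, hu⟩ : ∃ u₁ u₂ : ℤ, (u₁ ≠ 0 ∨ u₂ ≠ 0) ∧
      (p * u₁ + q * u₂ = u₁ ∧ r * u₁ + (-p) * u₂ = u₂) := by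
    by_cases hq : q = 0 ∧ p = 1
    · refine ⟨1 + p, r, Or.inl (by rw [hq.2]; norm_num), ?_, by ring⟩
      nlinarith [hrel]
    · refine ⟨q, 1 - p, ?_, by ring, by nlinarith [hrel]⟩
      by_contra hcon
      push Not at hcon
      exact hq ⟨hcon.1, by linarith [hcon.2]⟩
  obtain ⟨g, w₁, w₂, hg, hgu₁, hgu₂, hcop⟩ := exists_primitive u₁ u₂ hu0
  have hw : p * w₁ + q * w₂ = w₁ ∧ r * w₁ + (-p) * w₂ = w₂ := by
    obtain ⟨h1, h2⟩ := hu
    rw [hgu₁, hgu₂] at h1 h2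
    constructor
    · have : g * (p * w₁ + q * w₂ - w₁) = 0 := by linarith
      have := (mul_eq_zero.1 this).resolve_left hg.ne'
      linarith
    · have : g * (r * w₁ + -p * w₂ - w₂) = 0 := by linarith
      have := (mul_eq_zero.1 this).resolve_left hg.ne'
      linarith
  obtain ⟨s, t, hst⟩ := hcop
  -- `δ₀ = (w₁ −t; w₂ s)`, `det = w₁ s + t w₂ = 1`
  -- `δ₀⁻¹ γ δ₀ = (1 x; 0 −1)` with `x` below; then shear by `k`.
  set x : ℤ := s * (p * (-t) + q * s) + t * (r * (-t) + -p * s) with hx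
  -- choose k with x + 2k ∈ {0, 1}
  set k : ℤ := -(x / 2) with hk
  have hx2 : x + 2 * k = x % 2 := by omega
  have hcases : x % 2 = 0 ∨ x % 2 = 1 := Int.emod_two_eq_zero_or_one x
  refine ⟨!![w₁, -t; w₂, s] * !![1, k; 0, 1], ?_, ?_⟩
  · rw [Matrix.det_mul, Matrix.det_fin_two_of, Matrix.det_fin_two_of]; linarith [hst]
  · have hdet2 : w₁ * (r * -t + -p * s) - w₂ * (p * -t + q * s) + 1 = 0 := by
      linear_combination (-t) * hw.2 + (-s) * hw.1 - hst
    have key : γ * (!![w₁, -t; w₂, s] * !![1, k; 0, 1]) =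
        (!![w₁, -t; w₂, s] * !![1, k; 0, 1]) * !![1, x + 2 * k; 0, -1] := by
      have eγ : γ = !![p, q; r, -p] := by
        ext i j; fin_cases i <;> fin_cases j <;> simp [h11] <;> rfl
      rw [eγ]
      ext i j
      fin_cases i <;> fin_cases j <;> simp [Matrix.mul_apply, Fin.sum_univ_two]
      · linear_combination hw.1
      · linear_combination k * hw.1 - t * hdet2 - (p * -t + q * s) * hst
      · linear_combination hw.2
      · linear_combination k * hw.2 + s * hdet2 - (r * -t + -p * s) * hst
    rcases hcases with h0 | h1
    · left; rw [key, hx2, h0]; rfl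
    · right; rw [key, hx2, h1]; rfl

/-! ## Elements of order `4` (`γ² = −1`): reduction of the definite form `Jγ` -/

/-- The binary quadratic form `Q(a, b) = r a² − 2p ab − q b²` attached to `γ = (p q; r −p)`
(the symmetric matrix `Jγ`, `J = (0 1; −1 0)`). [folklore] -/
def Q (r p q a b : ℤ) : ℤ := r * a ^ 2 - 2 * p * a * b - q * b ^ 2

/-- `r Q(a,b) = (ra − pb)² + b²` when `p² + qr = −1`. [folklore] -/
theorem r_mul_Q {r p q : ℤ} (h : p ^ 2 + q * r = -1) (a b : ℤ) :
    r * Q r p q a b = (r * a - p * b) ^ 2 + b ^ 2 := by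
  unfold Q; linear_combination (-(b ^ 2)) * h

/-- `Q` is positive definite for `r > 0`. [folklore] -/
theorem Q_pos {r p q : ℤ} (hr : 0 < r) (h : p ^ 2 + q * r = -1) {a b : ℤ} (hab : a ≠ 0 ∨ b ≠ 0) :
    0 < Q r p q a b := by
  have h1 := r_mul_Q h a b
  have hpos : 0 < (r * a - p * b) ^ 2 + b ^ 2 := by
    rcases hab with ha | hb
    · by_cases hb : b = 0
      · subst hb
        have : r * a ≠ 0 := mul_ne_zero hr.ne' ha
        have : 0 < (r * a - p * 0) ^ 2 := by rw [mul_zero, sub_zero]; positivity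
        linarith
      · have : 0 < b ^ 2 := by positivity
        nlinarith [sq_nonneg (r * a - p * b)]
    · have : 0 < b ^ 2 := by positivity
      nlinarith [sq_nonneg (r * a - p * b)]
  by_contra hle
  push Not at hle
  have : r * Q r p q a b ≤ 0 := mul_nonpos_of_nonneg_of_nonpos hr.le hle
  linarith

/-- `Q(ga, gb) = g² Q(a, b)`. [folklore] -/
theorem Q_smul (r p q g a b : ℤ) : Q r p q (g * a) (g * b) = g ^ 2 * Q r p q a b := by
  unfold Q; ring

/-- **Normal form of integral elements of order `4`, positive case**: if `γ = (p q; r −p)` has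
`det γ = 1` and `r > 0` then `γ δ = δ S` for some `δ ∈ SL₂(ℤ)` (reduction of the positive
definite form `Jγ` of discriminant `−4` to `x² + y²`). [folklore] -/
theorem order_four_normal_form_pos (γ : Matrix (Fin 2) (Fin 2) ℤ) (htr : γ 0 0 + γ 1 1 = 0)
    (hdet : γ.det = 1) (hr : 0 < γ 1 0) :
    ∃ δ : Matrix (Fin 2) (Fin 2) ℤ, δ.det = 1 ∧ γ * δ = δ * S := by
  set p := γ 0 0
  set q := γ 0 1
  set r := γ 1 0
  have h11 : γ 1 1 = -p := by linarith
  rw [Matrix.det_fin_two, h11] at hdet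
  have hrel : p ^ 2 + q * r = -1 := by linarith
  -- minimisation of `Q` over nonzero vectors
  have hex : ∃ n : ℕ, ∃ a b : ℤ, (a ≠ 0 ∨ b ≠ 0) ∧ Q r p q a b = n :=
    ⟨(Q r p q 1 0).toNat, 1, 0, Or.inl one_ne_zero,
      (Int.toNat_of_nonneg (Q_pos hr hrel (Or.inl one_ne_zero)).le).symm⟩
  classical
  set m : ℕ := Nat.find hex with hm
  obtain ⟨a₀, b₀, hab0, hQm⟩ : ∃ a b : ℤ, (a ≠ 0 ∨ b ≠ 0) ∧ Q r p q a b = m := Nat.find_spec hex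
  have hmin : ∀ a b : ℤ, (a ≠ 0 ∨ b ≠ 0) → (m : ℤ) ≤ Q r p q a b := by
    intro a b hab
    have hQ := Q_pos hr hrel hab
    have h1 : (m : ℕ) ≤ (Q r p q a b).toNat :=
      Nat.find_min' hex ⟨a, b, hab, (Int.toNat_of_nonneg hQ.le).symm⟩
    have h2 : ((Q r p q a b).toNat : ℤ) = Q r p q a b := Int.toNat_of_nonneg hQ.le
    calc (m : ℤ) ≤ ((Q r p q a b).toNat : ℤ) := by exact_mod_cast h1
      _ = _ := h2
  have hmpos : 0 < (m : ℤ) := by rw [← hQm]; exact Q_pos hr hrel hab0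
  -- the minimiser is primitive
  have hcop : IsCoprime a₀ b₀ := by
    obtain ⟨g, w₁, w₂, hg, hg₁, hg₂, hcop⟩ := exists_primitive a₀ b₀ hab0
    have hw0 : w₁ ≠ 0 ∨ w₂ ≠ 0 := by
      rcases hab0 with h | h
      · left; rintro rfl; rw [mul_zero] at hg₁; exact h hg₁
      · right; rintro rfl; rw [mul_zero] at hg₂; exact h hg₂
    have hQw := hmin w₁ w₂ hw0
    rw [hg₁, hg₂, Q_smul] at hQm
    have hQwpos := Q_pos hr hrel hw0
    have hg1 : g = 1 := by
      by_contra hne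
      have hg2 : 2 ≤ g := by omega
      have : 4 * Q r p q w₁ w₂ ≤ g ^ 2 * Q r p q w₁ w₂ :=
        mul_le_mul_of_nonneg_right (by nlinarith) hQwpos.le
      linarith
    rw [hg1, one_mul] at hg₁ hg₂
    rwa [hg₁, hg₂]
  obtain ⟨s, t, hst⟩ := hcop
  -- shear parameter
  set B : ℤ := -(r * a₀ * t) - p * a₀ * s + p * b₀ * t - q * b₀ * s with hB
  set k : ℤ := -(B / m) with hk
  have hρ : 0 ≤ (m : ℤ) * k + B ∧ (m : ℤ) * k + B < m := by
    have h1 := Int.emod_nonneg B hmpos.ne'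
    have h2 := Int.emod_lt_of_pos B hmpos
    have h3 := Int.emod_add_mul_ediv B m
    have e : (m : ℤ) * k + B = B % m := by rw [hk, mul_neg]; linarith
    rw [e]; exact ⟨h1, h2⟩
  -- the columns of `δ`
  set u : ℤ := a₀ * k - t with hu
  set v : ℤ := b₀ * k + s with hv
  have hδdet : a₀ * v - b₀ * u = 1 := by rw [hu, hv]; linear_combination hst
  have huv0 : u ≠ 0 ∨ v ≠ 0 := by
    by_contra hcon; push Not at hcon
    rw [hcon.1, hcon.2] at hδdet; simp at hδdet
  -- the reduced coefficients
  have hA00 : Q r p q a₀ b₀ = m := hQm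
  have hA01 : r * a₀ * u - p * (a₀ * v + b₀ * u) - q * b₀ * v = (m : ℤ) * k + B := by
    rw [hu, hv, hB, ← hA00]; unfold Q; ring
  have hA11 := hmin u v huv0
  have hdetA : Q r p q a₀ b₀ * Q r p q u v - (r * a₀ * u - p * (a₀ * v + b₀ * u) - q * b₀ * v) ^ 2 =
      (a₀ * v - b₀ * u) ^ 2 * (-(q * r) - p ^ 2) := by unfold Q; ring
  rw [hδdet, one_pow, one_mul, hA00, hA01, show -(q * r) - p ^ 2 = 1 by linarith] at hdetA
  -- `m = 1`, `mk + B = 0`, `Q(u,v) = 1`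
  obtain ⟨hρ0, hρ1⟩ := hρ
  have hm1 : (m : ℤ) = 1 := by
    by_contra hne
    have hm2 : 2 ≤ (m : ℤ) := by omega
    -- m * Q(u,v) = 1 + ρ², ρ ≤ m - 1, Q(u,v) ≥ m
    have h1 : (m : ℤ) * m ≤ (m : ℤ) * Q r p q u v := mul_le_mul_of_nonneg_left hA11 hmpos.le
    have h2 : ((m : ℤ) * k + B) ^ 2 ≤ ((m : ℤ) - 1) ^ 2 := by
      have : (m : ℤ) * k + B ≤ m - 1 := by omega
      nlinarith
    nlinarith
  have hρz : (m : ℤ) * k + B = 0 := by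
    have : ((m : ℤ) * k + B) < 1 := by rw [← hm1]; exact hρ1
    omega
  rw [hρz, hm1] at hdetA
  have hQuv : Q r p q u v = 1 := by linarith
  rw [hm1] at hA00; rw [hρz] at hA01
  -- conclude `γ δ = δ S` with `δ = (a₀ u; b₀ v)`
  refine ⟨!![a₀, u; b₀, v], ?_, ?_⟩
  · rw [Matrix.det_fin_two_of]; linarith [hδdet]
  · have eγ : γ = !![p, q; r, -p] := by
      ext i j; fin_cases i <;> fin_cases j <;> simp [h11] <;> rfl
    -- determinant forms of the reduced coefficients
    have E2 : a₀ * (r * a₀ - p * b₀) - b₀ * (p * a₀ + q * b₀) = 1 := by rw [← hA00]; unfold Q; ring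
    have E3 : u * (r * a₀ - p * b₀) - v * (p * a₀ + q * b₀) = 0 := by
      linear_combination hA01 + 0 * hδdet
    have E5 : u * (r * u - p * v) - v * (p * u + q * v) = 1 := by rw [← hQuv]; unfold Q; ring
    have E4 : a₀ * (r * u - p * v) - b₀ * (p * u + q * v) = 0 := by linear_combination E3
    rw [eγ, S]
    ext i j
    fin_cases i <;> fin_cases j <;> simp [Matrix.mul_apply, Fin.sum_univ_two]
    · linear_combination (-(p * a₀ + q * b₀)) * hδdet - a₀ * E3 + u * E2
    · linear_combination (-(p * u + q * v)) * hδdet + u * E4 - a₀ * E5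
    · linear_combination (-(r * a₀ - p * b₀)) * hδdet - b₀ * E3 + v * E2
    · linear_combination (-(r * u - p * v)) * hδdet + v * E4 - b₀ * E5

/-- **Normal form of integral elements of order `4`**: an integral `2 × 2` matrix with trace `0`
and determinant `1` satisfies `γ δ = δ S` or `γ δ = δ (−S)` for some `δ ∈ SL₂(ℤ)` (one
`GL₂(ℤ)`-conjugacy class of elements of order `4`, up to sign). [folklore] -/
theorem order_four_normal_form (γ : Matrix (Fin 2) (Fin 2) ℤ) (htr : γ 0 0 + γ 1 1 = 0) (hdet : γ.det = 1) :
    ∃ δ : Matrix (Fin 2) (Fin 2) ℤ, δ.det = 1 ∧ (γ * δ = δ * S ∨ γ * δ = δ * (-S)) := by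
  have hr0 : γ 1 0 ≠ 0 := by
    intro h0
    rw [Matrix.det_fin_two, h0, mul_zero, sub_zero] at hdet
    have h11 : γ 1 1 = -γ 0 0 := by linarith
    rw [h11] at hdet
    nlinarith [sq_nonneg (γ 0 0)]
  rcases lt_or_gt_of_ne hr0 with hneg | hpos
  · -- apply the positive case to `−γ`
    have htr' : (-γ) 0 0 + (-γ) 1 1 = 0 := by simp only [Matrix.neg_apply]; linarith
    have hdet' : (-γ).det = 1 := by
      rw [Matrix.det_neg, hdet]; norm_num
    have hr' : 0 < (-γ) 1 0 := by simp only [Matrix.neg_apply]; linarith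
    obtain ⟨δ, hδ, h⟩ := order_four_normal_form_pos (-γ) htr' hdet' hr'
    refine ⟨δ, hδ, Or.inr ?_⟩
    rw [Matrix.neg_mul] at h
    rw [Matrix.mul_neg, ← h, neg_neg]
  · obtain ⟨δ, hδ, h⟩ := order_four_normal_form_pos γ htr hdet hpos
    exact ⟨δ, hδ, Or.inl h⟩

/-- **Trace-zero elements of `GL₂(ℤ)`**: an integral `2 × 2` matrix with trace `0` and
determinant `±1` is `SL₂(ℤ)`-conjugate to one of `diag(1,−1)`, `(1 1; 0 −1)`, `S`, `−S`.
[folklore] -/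
theorem trace_zero_normal_form (γ : Matrix (Fin 2) (Fin 2) ℤ) (htr : γ 0 0 + γ 1 1 = 0)
    (hdet : γ.det = 1 ∨ γ.det = -1) :
    ∃ δ : Matrix (Fin 2) (Fin 2) ℤ, δ.det = 1 ∧
      (γ * δ = δ * γ₁ ∨ γ * δ = δ * γ₂ ∨ γ * δ = δ * S ∨ γ * δ = δ * (-S)) := by
  rcases hdet with h | h
  · obtain ⟨δ, hδ, h'⟩ := order_four_normal_form γ htr h
    exact ⟨δ, hδ, by tauto⟩
  · obtain ⟨δ, hδ, h'⟩ := involution_normal_form γ htr h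
    exact ⟨δ, hδ, by tauto⟩

end GL2ZNormalForm

end Literature.LinearAlgebra.Matrix
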